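import Mathlib
import Summits.QuantumFields.YangMills.Theses.MirrorModularBoosts
import Literature.MathematicalPhysics.QuantumFieldTheory.OSSectorContinuation
import Literature.MathematicalPhysics.QuantumFieldTheory.OSReconstructionNoE1Proofs

/-!
# Candidate proof of `stub_discSections_of_sectorExtension` (line `two-mirror-lightcone-slots`,
crux stmt-QuantumFields-9664) — drefute by-product, refuter-drefute-stmt-QuantumFields-9664-0.

Thales for the whole ball: `z ↦ ((t+z)/√2, (t−z)/√2)` maps `ball 0 t` into `sectorRegion 1 (π/2)`
(`|arg u| + |arg u'| < π/2 ⇔ (Im z)² < t² − (Re z)²`), then the e₀ read-back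
`𝔖(ΘG* ⊗ G_{t e₀ + b e₁}) = ⟪Ψ_G, e^{-tH} U(b e₁) Ψ_G⟫`.
-/

noncomputable section

namespace DrefuteProofs

open MeasureTheory Complex Set Filter
open scoped InnerProductSpace ComplexConjugate
open Literature.MathematicalPhysics.QuantumLattice Literature.MathematicalPhysics.AQFT
  Literature.MathematicalPhysics.QuantumFieldTheory
open Summit.QuantumFields.YangMills.Theses.MirrorModularBoosts
open Literature.Analysis.Complex

local notation "E4" => EuclideanSpace ℝ (Fin 4)

/-- `arg z = arctan (Im z / Re z)` on the right half-plane. -/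
theorem arg_eq_arctan_of_re_pos {z : ℂ} (hz : 0 < z.re) : Complex.arg z = Real.arctan (z.im / z.re) := by
  have h1 : |Complex.arg z| < Real.pi / 2 := Complex.abs_arg_lt_pi_div_two_iff.2 (Or.inl hz)
  rw [abs_lt] at h1
  rw [← Complex.tan_arg, Real.arctan_tan h1.1 h1.2]

/-- `|arctan x| = arctan |x|`. -/
theorem abs_arctan_eq (x : ℝ) : |Real.arctan x| = Real.arctan |x| := by
  rcases le_or_gt 0 x with hx | hx
  · rw [abs_of_nonneg hx, abs_of_nonneg (Real.arctan_nonneg.2 hx)]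
  · rw [abs_of_neg hx, abs_of_neg (Real.arctan_lt_zero.2 hx), Real.arctan_neg]

/-- The boost chart `z ↦ ((t+z)/√2, (t−z)/√2)`. -/
def boostChart (t : ℝ) (z : ℂ) : Fin 2 → ℂ :=
  ![((t : ℂ) + z) / (Real.sqrt 2 : ℂ), ((t : ℂ) - z) / (Real.sqrt 2 : ℂ)]

theorem differentiable_boostChart (t : ℝ) : Differentiable ℂ (boostChart t) := by
  refine differentiable_pi.2 fun j => ?_
  fin_cases j
  · change Differentiable ℂ fun z : ℂ => ((t : ℂ) + z) / (Real.sqrt 2 : ℂ)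
    fun_prop
  · change Differentiable ℂ fun z : ℂ => ((t : ℂ) - z) / (Real.sqrt 2 : ℂ)
    fun_prop

/-- **Thales on the whole ball**: the chart maps `ball 0 t` into the two-slot sector region. -/
theorem boostChart_mem_sectorRegion {t : ℝ} (ht : 0 < t) {z : ℂ} (hz : z ∈ Metric.ball (0 : ℂ) t) :
    boostChart t z ∈ sectorRegion 1 (Real.pi / 2) := by
  rw [Metric.mem_ball, dist_zero_right] at hz
  have hs : 0 < Real.sqrt 2 := Real.sqrt_pos.2 two_pos
  have hre : |z.re| < t := lt_of_le_of_lt (Complex.abs_re_le_norm z) hz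
  obtain ⟨hre1, hre2⟩ := abs_lt.1 hre
  have hsq : z.re ^ 2 + z.im ^ 2 < t ^ 2 := by
    have h1 : ‖z‖ ^ 2 = z.re ^ 2 + z.im ^ 2 := by
      rw [Complex.sq_norm, Complex.normSq_apply]; ring
    have h2 : ‖z‖ ^ 2 < t ^ 2 := by
      have := norm_nonneg z
      nlinarith
    linarith
  set u : ℂ := ((t : ℂ) + z) / (Real.sqrt 2 : ℂ) with hu
  set u' : ℂ := ((t : ℂ) - z) / (Real.sqrt 2 : ℂ) with hu'
  have hure : u.re = (t + z.re) / Real.sqrt 2 := by rw [hu, Complex.div_ofReal_re]; simp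
  have huim : u.im = z.im / Real.sqrt 2 := by rw [hu, Complex.div_ofReal_im]; simp
  have hu're : u'.re = (t - z.re) / Real.sqrt 2 := by rw [hu', Complex.div_ofReal_re]; simp
  have hu'im : u'.im = (-z.im) / Real.sqrt 2 := by rw [hu', Complex.div_ofReal_im]; simp
  have hA : 0 < t + z.re := by linarith
  have hB : 0 < t - z.re := by linarith
  have hupos : 0 < u.re := by rw [hure]; positivity
  have hu'pos : 0 < u'.re := by rw [hu're]; positivity
  have hq : z.im / Real.sqrt 2 / ((t + z.re) / Real.sqrt 2) = z.im / (t + z.re) := by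
    field_simp
  have hq' : (-z.im) / Real.sqrt 2 / ((t - z.re) / Real.sqrt 2) = -(z.im / (t - z.re)) := by
    field_simp
  have hargu : |Complex.arg u| = Real.arctan (|z.im| / (t + z.re)) := by
    rw [arg_eq_arctan_of_re_pos hupos, huim, hure, hq, abs_arctan_eq, abs_div, abs_of_pos hA]
  have hargu' : |Complex.arg u'| = Real.arctan (|z.im| / (t - z.re)) := by
    rw [arg_eq_arctan_of_re_pos hu'pos, hu'im, hu're, hq', Real.arctan_neg, abs_neg, abs_arctan_eq,
      abs_div, abs_of_pos hB]
  have hprod : |z.im| / (t + z.re) * (|z.im| / (t - z.re)) < 1 := by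
    rw [div_mul_div_comm, div_lt_one (mul_pos hA hB)]
    have : |z.im| * |z.im| = z.im ^ 2 := by rw [← sq, sq_abs]
    rw [this]
    nlinarith
  have hsum : |Complex.arg u| + |Complex.arg u'| < Real.pi / 2 := by
    rw [hargu, hargu']
    exact Real.arctan_add_arctan_lt_pi_div_two hprod
  refine ⟨?_, ?_⟩
  · intro j
    fin_cases j
    · exact hupos
    · exact hu'pos
  · rw [Fin.sum_univ_two]
    exact hsum

/-- Time-then-space translation is one translation by `t e₀ + b e₁` (planner's bookkeeping lemma). -/
theorem translateMulti_time_space {m : ℕ} (t b : ℝ) (G : SchwartzMap (Fin m → E4) ℂ) :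
    translateMulti (SchwingerFamily.timeVec t)
        (translateMulti (spatialPart 0 (b • (EuclideanSpace.single 1 1 : E4))) G) =
      translateMulti (t • EuclideanSpace.single 0 1 + b • EuclideanSpace.single 1 1) G := by
  have hv : (SchwingerFamily.timeVec t + spatialPart 0 (b • (EuclideanSpace.single 1 1 : E4)) : E4) =
      t • EuclideanSpace.single 0 1 + b • EuclideanSpace.single 1 1 := by
    ext i
    fin_cases i <;> simp [SchwingerFamily.timeVec, spatialPart_apply]
  rw [translateMulti_translateMulti, hv]

/-- **Candidate proof of the stub** (signature verbatim from the ledger, skeleton sha fe3e5eda…). -/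
theorem stub_discSections_of_sectorExtension (S : SchwingerFamily E4) (h : OSReconstructionNoE1 S.toLabelled) {m : ℕ} (G : SchwartzMap (Fin m → E4) ℂ) (hG : IsTimeOrdered G) (M : ℝ) (Φ : (Fin 2 → ℂ) → ℂ) (hΦd : DifferentiableOn ℂ Φ (Literature.Analysis.Complex.sectorRegion 1 (Real.pi / 2))) (hΦb : ∀ w ∈ Literature.Analysis.Complex.sectorRegion 1 (Real.pi / 2), ‖Φ w‖ ≤ M) (hΦr : ∀ u : Fin 2 → ℝ, (∀ j, 0 < u j) → Φ (fun j => (u j : ℂ)) = S (m + m) ((osAdjoint G).appendTensor (translateMulti (((u 0 + u 1) / Real.sqrt 2) • EuclideanSpace.single 0 1 + ((u 0 - u 1) / Real.sqrt 2) • EuclideanSpace.single 1 1) G))) : ∀ t : ℝ, 0 < t → ∃ f : ℂ → ℂ, DifferentiableOn ℂ f (Metric.ball 0 t) ∧ (∀ z ∈ Metric.ball (0 : ℂ) t, ‖f z‖ ≤ M) ∧ ∀ b : ℝ, |b| < t → f b = ⟪h.fieldVec m (fun _ => ()) G hG, h.transfer t (h.translate (b • EuclideanSpace.single 1 1) (h.fieldVec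 m (fun _ => ()) G hG))⟫_ℂ := by
  intro t ht
  have hs : 0 < Real.sqrt 2 := Real.sqrt_pos.2 two_pos
  have hs2 : Real.sqrt 2 * Real.sqrt 2 = 2 := Real.mul_self_sqrt (by norm_num)
  refine ⟨fun z => Φ (boostChart t z), ?_, ?_, ?_⟩
  · exact hΦd.comp (differentiable_boostChart t).differentiableOn
      (fun z hz => boostChart_mem_sectorRegion ht hz)
  · intro z hz
    exact hΦb _ (boostChart_mem_sectorRegion ht hz)
  · intro b hb
    obtain ⟨hb1, hb2⟩ := abs_lt.1 hb
    -- the real light-cone coordinates of the boost point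
    obtain ⟨u, hu0, hu1⟩ : ∃ u : Fin 2 → ℝ, u 0 = (t + b) / Real.sqrt 2 ∧ u 1 = (t - b) / Real.sqrt 2 :=
      ⟨![(t + b) / Real.sqrt 2, (t - b) / Real.sqrt 2], rfl, rfl⟩
    have hupos : ∀ j, 0 < u j := by
      intro j
      fin_cases j
      · show 0 < u 0
        rw [hu0]; exact div_pos (by linarith) hs
      · show 0 < u 1
        rw [hu1]; exact div_pos (by linarith) hs
    have hchart : boostChart t (b : ℂ) = fun j => ((u j : ℝ) : ℂ) := by
      funext j
      fin_cases j
      · show ((t : ℂ) + (b : ℂ)) / (Real.sqrt 2 : ℂ) = ((u 0 : ℝ) : ℂ)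
        rw [hu0]; push_cast; ring
      · show ((t : ℂ) - (b : ℂ)) / (Real.sqrt 2 : ℂ) = ((u 1 : ℝ) : ℂ)
        rw [hu1]; push_cast; ring
    have h1 : (u 0 + u 1) / Real.sqrt 2 = t := by
      rw [hu0, hu1]
      field_simp
      rw [Real.sq_sqrt (by norm_num : (0:ℝ) ≤ 2)]; ring
    have h2 : (u 0 - u 1) / Real.sqrt 2 = b := by
      rw [hu0, hu1]
      field_simp
      rw [Real.sq_sqrt (by norm_num : (0:ℝ) ≤ 2)]; ring
    show Φ (boostChart t (b : ℂ)) = _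
    rw [hchart, hΦr u hupos, h1, h2]
    -- read back in the e₀ frame
    rw [OSReconstructionNoE1.translate_fieldVec, OSReconstructionNoE1.transfer_fieldVec _ ht.le]
    have hH' : IsAppendTensorOf ((osAdjoint G).appendTensor
        (translateMulti (t • EuclideanSpace.single 0 1 + b • EuclideanSpace.single 1 1) G))
        (osAdjoint G) (translateMulti (SchwingerFamily.timeVec t)
          (translateMulti (spatialPart 0 (b • (EuclideanSpace.single 1 1 : E4))) G)) := by
      rw [translateMulti_time_space]
      exact isAppendTensorOf_appendTensor _ _
    rw [h.inner_fieldVec_fieldVec (fun _ => ()) (fun _ => ()) hG _ hH']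
    rfl

end DrefuteProofs
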